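import Summits.ValiantsHypothesis.ValiantsHypothesis.Theorems.FreeSubtorusOrbitDimensionBoundStubStableReductionEngel
import Summits.ValiantsHypothesis.ValiantsHypothesis.Theorems.FreeSubtorusOrbitDimensionBoundStubStableReductionOrbit

/-!
# `OrbitDimensionBound` (stmt-ValiantsHypothesis-16133), rung line `square_covering` — stub `stub_stableReduction`,
# infrastructure: the common kernel of the radical is a lift-stable equal-dimension sub-pencil (plan step I5a, part 2)

Seventh helper file toward stub 1 `stub_stableReduction` (plan HOME/lmr/NOTE-p4g12-16133-stableReduction-plan.md).
For a REGULAR (`det N ≠ 0`) pencil `N` of size `k₀ ≥ 1` with LOCAL endomorphism algebra and NON-ZERO radical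
`J = {(x_W, x_V) ∈ End N : x_W nilpotent}`, the pair of common kernels
`K = (⋂_{x ∈ J} ker x_V, ⋂_{x ∈ J} ker x_W)` is a sub-pencil of `N` (every coefficient matrix maps `K_V` into `K_W`),
of EQUAL dimensions (`finrank_ker_eq_of_hom` + the lattice property of equal-dimension sub-pencils,
`subpencil_iInf_fin`), non-zero (Engel, `exists_common_kernel`), proper, and STABLE under every lift `(G, H)` of every
substitution `γ` to `N` (`radical_conj`: lifts normalise `End N` and its radical):
**`exists_stable_subpencil_of_radical`**.  Also `exists_radical_of_not_schurian`: a local non-Schurian regular pencil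
has non-zero radical.

Helper mode (`--supports stmt-ValiantsHypothesis-16133 --as helper`).  Honest framing: infrastructure toward ONE
registered stub of a dormant rung line whose core `stub_gradedPowerCount` is OPEN; `OrbitDimensionBound`,
`FreeSubtorus` and VP ≠ VNP are OPEN and not moved.

## References
* N. Jacobson, *Basic Algebra II*, 2nd ed. (1989), §3.4, §4.1 — orientation only.
-/

set_option linter.dupNamespace false

namespace Summit.ValiantsHypothesis.ValiantsHypothesis.Theorems.FreeSubtorusOrbitDimensionBound.SquareCovering

open Matrix MvPolynomial Finset Module.End
open Literature.Computability.AlgebraicComplexity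
open Summit.ValiantsHypothesis.ValiantsHypothesis.Theorems.FreeSubtorusOrbitDimensionBound.SignCovering.PerSummand

/-! ### §1 Regular pencils: constant factors are determined -/

section Regular

variable {σ : Type*} {k₀ : ℕ}

/-- For `det N ≠ 0`, `X N = 0` forces `X = 0` (`X` constant). [folklore] -/
theorem eq_zero_of_map_C_mul_eq_zero (N : Matrix (Fin k₀) (Fin k₀) (MvPolynomial σ ℂ)) (hN : N.det ≠ 0)
    (X : Matrix (Fin k₀) (Fin k₀) ℂ) (h : X.map (C (σ := σ)) * N = 0) : X = 0 := by
  have h1 : N.det • X.map (C (σ := σ)) = 0 := by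
    have h2 := congrArg (· * N.adjugate) h
    simp only [Matrix.zero_mul, Matrix.mul_assoc, Matrix.mul_adjugate, Matrix.mul_smul, Matrix.mul_one] at h2
    exact h2
  ext i j
  have h3 := congrFun (congrFun h1 i) j
  rw [Matrix.smul_apply, Matrix.map_apply, smul_eq_mul, Matrix.zero_apply, mul_eq_zero] at h3
  rcases h3 with h3 | h3
  · exact absurd h3 hN
  · exact (C_eq_zero.1 h3)

/-- For `det N ≠ 0`, `N Y = 0` forces `Y = 0` (`Y` constant). [folklore] -/
theorem eq_zero_of_mul_map_C_eq_zero (N : Matrix (Fin k₀) (Fin k₀) (MvPolynomial σ ℂ)) (hN : N.det ≠ 0)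
    (Y : Matrix (Fin k₀) (Fin k₀) ℂ) (h : N * Y.map (C (σ := σ)) = 0) : Y = 0 := by
  have h1 : N.det • Y.map (C (σ := σ)) = 0 := by
    have h2 := congrArg (N.adjugate * ·) h
    simp only [Matrix.mul_zero, ← Matrix.mul_assoc, Matrix.adjugate_mul, Matrix.smul_mul, Matrix.one_mul] at h2
    exact h2
  ext i j
  have h3 := congrFun (congrFun h1 i) j
  rw [Matrix.smul_apply, Matrix.map_apply, smul_eq_mul, Matrix.zero_apply, mul_eq_zero] at h3
  rcases h3 with h3 | h3
  · exact absurd h3 hN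
  · exact (C_eq_zero.1 h3)

/-- **A local non-Schurian regular pencil has non-zero radical**: a non-scalar endomorphism pair `(g, h)` gives
`(g - μ, h - μ) ∈ J` with `g - μ ≠ 0`. [folklore] -/
theorem exists_radical_of_not_schurian (N : Matrix (Fin k₀) (Fin k₀) (MvPolynomial σ ℂ)) (hN : N.det ≠ 0)
    (hloc : ∀ g h : Matrix (Fin k₀) (Fin k₀) ℂ, g.map C * N = N * h.map C →
      ∃ μ : ℂ, IsNilpotent (g - μ • (1 : Matrix (Fin k₀) (Fin k₀) ℂ)) ∧ IsNilpotent (h - μ • (1 : Matrix (Fin k₀) (Fin k₀) ℂ)))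
    (hns : ∃ g h : Matrix (Fin k₀) (Fin k₀) ℂ, g.map (C (σ := σ)) * N = N * h.map (C (σ := σ)) ∧
      ∀ μ : ℂ, ¬ (g = μ • (1 : Matrix (Fin k₀) (Fin k₀) ℂ) ∧ h = μ • (1 : Matrix (Fin k₀) (Fin k₀) ℂ))) :
    ∃ xW xV : Matrix (Fin k₀) (Fin k₀) ℂ, xW.map (C (σ := σ)) * N = N * xV.map (C (σ := σ)) ∧
      IsNilpotent xW ∧ xW ≠ 0 := by
  obtain ⟨g, h, hgh, hne⟩ := hns
  obtain ⟨μ, hgn, hhn⟩ := hloc g h hgh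
  have hx : (g - μ • (1 : Matrix (Fin k₀) (Fin k₀) ℂ)).map (C (σ := σ)) * N =
      N * (h - μ • (1 : Matrix (Fin k₀) (Fin k₀) ℂ)).map (C (σ := σ)) := hom_sub hgh (hom_smul_one μ N)
  refine ⟨_, _, hx, hgn, fun h0 => hne μ ⟨sub_eq_zero.1 h0, ?_⟩⟩
  rw [h0, Matrix.map_zero C C_0, Matrix.zero_mul] at hx
  exact sub_eq_zero.1 (eq_zero_of_mul_map_C_eq_zero N hN _ hx.symm)

/-- **Kernels of an endomorphism pair have equal dimensions** (regular `N`): `(ker x_V, ker x_W)` and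
`(im x_V, im x_W)` are sub-pencils, so Frobenius–König and rank–nullity balance. [folklore] -/
theorem finrank_ker_eq_of_hom (N : Matrix (Fin k₀) (Fin k₀) (MvPolynomial σ ℂ)) (hN : N.det ≠ 0)
    {xW xV : Matrix (Fin k₀) (Fin k₀) ℂ} (hx : xW.map (C (σ := σ)) * N = N * xV.map (C (σ := σ))) :
    (∀ (d : σ →₀ ℕ) (v : Fin k₀ → ℂ), v ∈ LinearMap.ker (Matrix.toLin' xV) →
      Matrix.toLin' (N.map (coeff d)) v ∈ LinearMap.ker (Matrix.toLin' xW)) ∧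
    Module.finrank ℂ (LinearMap.ker (Matrix.toLin' xV)) = Module.finrank ℂ (LinearMap.ker (Matrix.toLin' xW)) := by
  have hker : ∀ (d : σ →₀ ℕ) (v : Fin k₀ → ℂ), v ∈ LinearMap.ker (Matrix.toLin' xV) →
      Matrix.toLin' (N.map (coeff d)) v ∈ LinearMap.ker (Matrix.toLin' xW) := by
    intro d v hv
    rw [LinearMap.mem_ker] at hv ⊢
    rw [← Matrix.toLin'_mul_apply, mul_map_coeff_eq_of_map_C_mul_eq N xW xV hx d, Matrix.toLin'_mul_apply, hv,
      map_zero]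
  have him : ∀ (d : σ →₀ ℕ) (w : Fin k₀ → ℂ), w ∈ LinearMap.range (Matrix.toLin' xV) →
      Matrix.toLin' (N.map (coeff d)) w ∈ LinearMap.range (Matrix.toLin' xW) := by
    intro d w hw
    obtain ⟨u, rfl⟩ := LinearMap.mem_range.1 hw
    refine LinearMap.mem_range.2 ⟨Matrix.toLin' (N.map (coeff d)) u, ?_⟩
    rw [← Matrix.toLin'_mul_apply, mul_map_coeff_eq_of_map_C_mul_eq N xW xV hx d, Matrix.toLin'_mul_apply]
  refine ⟨hker, ?_⟩
  have h1 := finrank_le_of_subpencil N hN _ _ hker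
  have h2 := finrank_le_of_subpencil N hN _ _ him
  have h3 := LinearMap.finrank_range_add_finrank_ker (Matrix.toLin' xV)
  have h4 := LinearMap.finrank_range_add_finrank_ker (Matrix.toLin' xW)
  rw [Module.finrank_fin_fun] at h3 h4
  omega

end Regular

/-! ### §2 Finite intersections of equal-dimension sub-pencils -/

section Lattice

variable {σ : Type*} {m : ℕ}

/-- **Finite intersections of equal-dimension sub-pencils are equal-dimension sub-pencils** (regular `M`).
[folklore] -/
theorem subpencil_iInf_fin (M : Matrix (Fin m) (Fin m) (MvPolynomial σ ℂ)) (hM : M.det ≠ 0) :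
    ∀ (q : ℕ) (fV fW : Fin q → Submodule ℂ (Fin m → ℂ)),
      (∀ i, ∀ (d : σ →₀ ℕ) (x : Fin m → ℂ), x ∈ fV i → Matrix.toLin' (M.map (coeff d)) x ∈ fW i) →
      (∀ i, Module.finrank ℂ (fV i) = Module.finrank ℂ (fW i)) →
      (∀ (d : σ →₀ ℕ) (x : Fin m → ℂ), x ∈ ⨅ i, fV i → Matrix.toLin' (M.map (coeff d)) x ∈ ⨅ i, fW i) ∧
        Module.finrank ℂ ↥(⨅ i, fV i) = Module.finrank ℂ ↥(⨅ i, fW i) := by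
  intro q
  induction q with
  | zero =>
    intro fV fW _ _
    rw [iInf_of_empty, iInf_of_empty]
    exact ⟨fun d x _ => Submodule.mem_top, rfl⟩
  | succ q ih =>
    intro fV fW hsub hdim
    have hsplit : ∀ (f : Fin (q + 1) → Submodule ℂ (Fin m → ℂ)), (⨅ i, f i) = f 0 ⊓ ⨅ i : Fin q, f i.succ := by
      intro f
      ext x
      simp [Submodule.mem_iInf, Submodule.mem_inf, Fin.forall_fin_succ]
    obtain ⟨hs, hd⟩ := ih (fun i => fV i.succ) (fun i => fW i.succ) (fun i => hsub i.succ) (fun i => hdim i.succ)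
    rw [hsplit fV, hsplit fW]
    exact ⟨subpencil_inf M _ _ _ _ (hsub 0) hs, (finrank_sup_inf_eq_of_subpencil M hM _ _ _ _ (hsub 0) hs (hdim 0) hd).2⟩

end Lattice

/-! ### §3 Lifts normalise the radical; the common kernel is a lift-stable equal-dimension sub-pencil -/

section Stable

variable {σ : Type*} [Fintype σ] [DecidableEq σ] {k₀ : ℕ}

/-- **Lifts normalise the radical**: if `N(γ·x) = G N(x) H⁻¹` and `(x_W, x_V) ∈ End N` with `x_W` nilpotent, then
`(G⁻¹ x_W G, H⁻¹ x_V H) ∈ End N` with `G⁻¹ x_W G` nilpotent. [folklore] -/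
theorem radical_conj (N : Matrix (Fin k₀) (Fin k₀) (MvPolynomial σ ℂ)) (γ : GL σ ℂ) (G H : GL (Fin k₀) ℂ)
    (hlift : Matrix.linSubstEntries γ N =
      (G : Matrix (Fin k₀) (Fin k₀) ℂ).map C * N * ((H⁻¹ : GL (Fin k₀) ℂ) : Matrix (Fin k₀) (Fin k₀) ℂ).map C)
    {xW xV : Matrix (Fin k₀) (Fin k₀) ℂ} (hx : xW.map (C (σ := σ)) * N = N * xV.map (C (σ := σ)))
    (hxn : IsNilpotent xW) :
    (((G⁻¹ : GL (Fin k₀) ℂ) : Matrix (Fin k₀) (Fin k₀) ℂ) * xW * (G : Matrix (Fin k₀) (Fin k₀) ℂ)).map (C (σ := σ)) * N =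
        N * (((H⁻¹ : GL (Fin k₀) ℂ) : Matrix (Fin k₀) (Fin k₀) ℂ) * xV * (H : Matrix (Fin k₀) (Fin k₀) ℂ)).map (C (σ := σ)) ∧
      IsNilpotent (((G⁻¹ : GL (Fin k₀) ℂ) : Matrix (Fin k₀) (Fin k₀) ℂ) * xW * (G : Matrix (Fin k₀) (Fin k₀) ℂ)) := by
  have h1 := hom_twist γ N N xW xV hx
  rw [hlift] at h1
  have hGG : (((G⁻¹ : GL (Fin k₀) ℂ) : Matrix (Fin k₀) (Fin k₀) ℂ)).map (C (σ := σ)) *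
      (G : Matrix (Fin k₀) (Fin k₀) ℂ).map (C (σ := σ)) = 1 := by
    rw [← Matrix.map_mul, Units.inv_mul, Matrix.map_one C C_0 C_1]
  have hHH : (((H⁻¹ : GL (Fin k₀) ℂ) : Matrix (Fin k₀) (Fin k₀) ℂ)).map (C (σ := σ)) *
      (H : Matrix (Fin k₀) (Fin k₀) ℂ).map (C (σ := σ)) = 1 := by
    rw [← Matrix.map_mul, Units.inv_mul, Matrix.map_one C C_0 C_1]
  refine ⟨?_, ?_⟩
  · calc (((G⁻¹ : GL (Fin k₀) ℂ) : Matrix (Fin k₀) (Fin k₀) ℂ) * xW * (G : Matrix (Fin k₀) (Fin k₀) ℂ)).map (C (σ := σ)) * N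
        = (((G⁻¹ : GL (Fin k₀) ℂ) : Matrix (Fin k₀) (Fin k₀) ℂ) * xW * (G : Matrix (Fin k₀) (Fin k₀) ℂ)).map (C (σ := σ)) *
            N * ((((H⁻¹ : GL (Fin k₀) ℂ) : Matrix (Fin k₀) (Fin k₀) ℂ)).map (C (σ := σ)) *
              (H : Matrix (Fin k₀) (Fin k₀) ℂ).map (C (σ := σ))) := by rw [hHH, Matrix.mul_one]
      _ = (((G⁻¹ : GL (Fin k₀) ℂ) : Matrix (Fin k₀) (Fin k₀) ℂ)).map (C (σ := σ)) *
            (xW.map (C (σ := σ)) * ((G : Matrix (Fin k₀) (Fin k₀) ℂ).map C * N *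
              ((H⁻¹ : GL (Fin k₀) ℂ) : Matrix (Fin k₀) (Fin k₀) ℂ).map C)) *
            (H : Matrix (Fin k₀) (Fin k₀) ℂ).map (C (σ := σ)) := by
          simp only [Matrix.map_mul, Matrix.mul_assoc]
      _ = (((G⁻¹ : GL (Fin k₀) ℂ) : Matrix (Fin k₀) (Fin k₀) ℂ)).map (C (σ := σ)) *
            ((G : Matrix (Fin k₀) (Fin k₀) ℂ).map C * N * ((H⁻¹ : GL (Fin k₀) ℂ) : Matrix (Fin k₀) (Fin k₀) ℂ).map C *
              xV.map (C (σ := σ))) * (H : Matrix (Fin k₀) (Fin k₀) ℂ).map (C (σ := σ)) := by rw [h1]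
      _ = ((((G⁻¹ : GL (Fin k₀) ℂ) : Matrix (Fin k₀) (Fin k₀) ℂ)).map (C (σ := σ)) *
            (G : Matrix (Fin k₀) (Fin k₀) ℂ).map (C (σ := σ))) * (N *
            (((H⁻¹ : GL (Fin k₀) ℂ) : Matrix (Fin k₀) (Fin k₀) ℂ).map C * xV.map (C (σ := σ)) *
              (H : Matrix (Fin k₀) (Fin k₀) ℂ).map (C (σ := σ)))) := by
          simp only [Matrix.mul_assoc]
      _ = N * (((H⁻¹ : GL (Fin k₀) ℂ) : Matrix (Fin k₀) (Fin k₀) ℂ) * xV * (H : Matrix (Fin k₀) (Fin k₀) ℂ)).map (C (σ := σ)) := by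
          rw [hGG, Matrix.one_mul, Matrix.map_mul, Matrix.map_mul]
  · obtain ⟨n, hn⟩ := hxn
    exact ⟨n, by rw [Units.conj_pow', hn, Matrix.mul_zero, Matrix.zero_mul]⟩

/-- **The common kernel of the radical is a lift-stable, proper, non-zero, equal-dimension sub-pencil**
(regular local `N` of size `k₀ ≥ 1` with non-zero radical). [folklore] -/
theorem exists_stable_subpencil_of_radical (N : Matrix (Fin k₀) (Fin k₀) (MvPolynomial σ ℂ)) (hk₀ : 0 < k₀)
    (hN : N.det ≠ 0)
    (hloc : ∀ g h : Matrix (Fin k₀) (Fin k₀) ℂ, g.map C * N = N * h.map C →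
      ∃ μ : ℂ, IsNilpotent (g - μ • (1 : Matrix (Fin k₀) (Fin k₀) ℂ)) ∧ IsNilpotent (h - μ • (1 : Matrix (Fin k₀) (Fin k₀) ℂ)))
    (hJ : ∃ xW xV : Matrix (Fin k₀) (Fin k₀) ℂ, xW.map (C (σ := σ)) * N = N * xV.map (C (σ := σ)) ∧
      IsNilpotent xW ∧ xW ≠ 0) :
    ∃ (KV KW : Submodule ℂ (Fin k₀ → ℂ)),
      (∀ (d : σ →₀ ℕ) (x : Fin k₀ → ℂ), x ∈ KV → Matrix.toLin' (N.map (coeff d)) x ∈ KW) ∧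
      Module.finrank ℂ KV = Module.finrank ℂ KW ∧ 0 < Module.finrank ℂ KV ∧ Module.finrank ℂ KV < k₀ ∧
      ∀ (γ : GL σ ℂ) (G H : GL (Fin k₀) ℂ), Matrix.linSubstEntries γ N =
          (G : Matrix (Fin k₀) (Fin k₀) ℂ).map C * N * ((H⁻¹ : GL (Fin k₀) ℂ) : Matrix (Fin k₀) (Fin k₀) ℂ).map C →
        (∀ x ∈ KV, Matrix.toLin' (H : Matrix (Fin k₀) (Fin k₀) ℂ) x ∈ KV) ∧
        (∀ x ∈ KW, Matrix.toLin' (G : Matrix (Fin k₀) (Fin k₀) ℂ) x ∈ KW) := by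
  classical
  -- the radical as a subspace of pairs (kept opaque: only its membership predicate is used)
  obtain ⟨Jsub, hmemJ⟩ : ∃ J : Submodule ℂ (Matrix (Fin k₀) (Fin k₀) ℂ × Matrix (Fin k₀) (Fin k₀) ℂ),
      ∀ p, p ∈ J ↔ (p.1.map (C (σ := σ)) * N = N * p.2.map (C (σ := σ)) ∧ IsNilpotent p.1) :=
    ⟨{ carrier := {p | p.1.map (C (σ := σ)) * N = N * p.2.map (C (σ := σ)) ∧ IsNilpotent p.1}
       add_mem' := by
         rintro ⟨xW, xV⟩ ⟨yW, yV⟩ ⟨hx, hxn⟩ ⟨hy, hyn⟩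
         exact ⟨hom_add hx hy, nilpair_add N hk₀ hloc hx hy hxn hyn⟩
       zero_mem' := ⟨by simp, IsNilpotent.zero⟩
       smul_mem' := by
         rintro c ⟨xW, xV⟩ ⟨hx, hxn⟩
         refine ⟨?_, nilpair_smul N hk₀ hloc hx hxn c⟩
         simp only [Prod.smul_fst, Prod.smul_snd]
         rw [← smul_one_mul c xW, ← smul_one_mul c xV]
         exact hom_comp hx (hom_smul_one c N) }, fun p => Iff.rfl⟩
  have hJ1 : ∀ p : Jsub, p.1.1.map (C (σ := σ)) * N = N * p.1.2.map (C (σ := σ)) := fun p => ((hmemJ p.1).1 p.2).1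
  have hJ2 : ∀ p : Jsub, IsNilpotent p.1.1 := fun p => ((hmemJ p.1).1 p.2).2
  obtain ⟨KV, hmemV⟩ : ∃ K : Submodule ℂ (Fin k₀ → ℂ), ∀ x, x ∈ K ↔ ∀ p : Jsub, Matrix.toLin' p.1.2 x = 0 :=
    ⟨⨅ p : Jsub, LinearMap.ker (Matrix.toLin' p.1.2), fun x => by simp only [Submodule.mem_iInf, LinearMap.mem_ker]⟩
  obtain ⟨KW, hmemW⟩ : ∃ K : Submodule ℂ (Fin k₀ → ℂ), ∀ x, x ∈ K ↔ ∀ p : Jsub, Matrix.toLin' p.1.1 x = 0 :=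
    ⟨⨅ p : Jsub, LinearMap.ker (Matrix.toLin' p.1.1), fun x => by simp only [Submodule.mem_iInf, LinearMap.mem_ker]⟩
  -- sub-pencil
  have hsub : ∀ (d : σ →₀ ℕ) (x : Fin k₀ → ℂ), x ∈ KV → Matrix.toLin' (N.map (coeff d)) x ∈ KW := by
    intro d x hx
    rw [hmemW]
    intro p
    rw [← Matrix.toLin'_mul_apply, mul_map_coeff_eq_of_map_C_mul_eq N _ _ (hJ1 p) d, Matrix.toLin'_mul_apply,
      (hmemV x).1 hx p, map_zero]
  -- equal dimensions, via a basis of the radical and finite intersections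
  have hdim : Module.finrank ℂ KV = Module.finrank ℂ KW := by
    set q := Module.finrank ℂ Jsub with hq
    let b : Module.Basis (Fin q) ℂ Jsub := Module.finBasis ℂ Jsub
    have hV : KV = ⨅ i : Fin q, LinearMap.ker (Matrix.toLin' (b i).1.2) := by
      ext x
      rw [hmemV, Submodule.mem_iInf]
      refine ⟨fun hx i => LinearMap.mem_ker.2 (hx (b i)), fun hx p => ?_⟩
      have hp : p.1.2 = ∑ i, b.repr p i • (b i).1.2 := by
        conv_lhs => rw [← b.sum_repr p]
        rw [Submodule.coe_sum, Prod.snd_sum]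
        exact Finset.sum_congr rfl fun i _ => by rw [Submodule.coe_smul, Prod.smul_snd]
      rw [hp, map_sum, LinearMap.sum_apply]
      exact Finset.sum_eq_zero fun i _ => by rw [map_smul, LinearMap.smul_apply, LinearMap.mem_ker.1 (hx i), smul_zero]
    have hW : KW = ⨅ i : Fin q, LinearMap.ker (Matrix.toLin' (b i).1.1) := by
      ext x
      rw [hmemW, Submodule.mem_iInf]
      refine ⟨fun hx i => LinearMap.mem_ker.2 (hx (b i)), fun hx p => ?_⟩
      have hp : p.1.1 = ∑ i, b.repr p i • (b i).1.1 := by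
        conv_lhs => rw [← b.sum_repr p]
        rw [Submodule.coe_sum, Prod.fst_sum]
        exact Finset.sum_congr rfl fun i _ => by rw [Submodule.coe_smul, Prod.smul_fst]
      rw [hp, map_sum, LinearMap.sum_apply]
      exact Finset.sum_eq_zero fun i _ => by rw [map_smul, LinearMap.smul_apply, LinearMap.mem_ker.1 (hx i), smul_zero]
    rw [hV, hW]
    exact (subpencil_iInf_fin N hN q _ _ (fun i => (finrank_ker_eq_of_hom N hN (hJ1 (b i))).1)
      (fun i => (finrank_ker_eq_of_hom N hN (hJ1 (b i))).2)).2
  -- non-zero (Engel)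
  have hpos : 0 < Module.finrank ℂ KV := by
    obtain ⟨v, hv0, hv⟩ := exists_common_kernel N hk₀ hloc
    have hvK : v ∈ KV := (hmemV v).2 fun p => hv _ _ (hJ1 p) (hJ2 p)
    by_contra h0
    have hbot : KV = ⊥ := Submodule.finrank_eq_zero.1 (Nat.eq_zero_of_not_pos h0)
    rw [hbot, Submodule.mem_bot] at hvK
    exact hv0 hvK
  -- proper
  have hlt : Module.finrank ℂ KV < k₀ := by
    obtain ⟨xW, xV, hx, hxn, hx0⟩ := hJ
    by_contra hge
    have hle : Module.finrank ℂ KW ≤ k₀ := by simpa [Module.finrank_fin_fun] using Submodule.finrank_le KW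
    have htop : KW = ⊤ :=
      Submodule.eq_top_of_finrank_eq (by rw [Module.finrank_fin_fun]; omega)
    apply hx0
    have h1 : Matrix.toLin' xW = 0 := by
      refine LinearMap.ext fun w => ?_
      have hw : w ∈ KW := htop ▸ Submodule.mem_top
      exact (hmemW w).1 hw ⟨(xW, xV), (hmemJ _).2 ⟨hx, hxn⟩⟩
    exact (LinearEquiv.map_eq_zero_iff Matrix.toLin').1 h1
  refine ⟨KV, KW, hsub, hdim, hpos, hlt, fun γ G H hlift => ⟨fun x hx => ?_, fun x hx => ?_⟩⟩
  · rw [hmemV] at hx ⊢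
    intro p
    obtain ⟨hc, hcn⟩ := radical_conj N γ G H hlift (hJ1 p) (hJ2 p)
    have hmem' : ((((G⁻¹ : GL (Fin k₀) ℂ) : Matrix (Fin k₀) (Fin k₀) ℂ) * p.1.1 * (G : Matrix (Fin k₀) (Fin k₀) ℂ),
        ((H⁻¹ : GL (Fin k₀) ℂ) : Matrix (Fin k₀) (Fin k₀) ℂ) * p.1.2 * (H : Matrix (Fin k₀) (Fin k₀) ℂ)) :
        Matrix (Fin k₀) (Fin k₀) ℂ × Matrix (Fin k₀) (Fin k₀) ℂ) ∈ Jsub := (hmemJ _).2 ⟨hc, hcn⟩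
    have h0 := hx ⟨_, hmem'⟩
    simp only at h0
    rw [← Matrix.toLin'_mul_apply,
      show p.1.2 * (H : Matrix (Fin k₀) (Fin k₀) ℂ) = (H : Matrix (Fin k₀) (Fin k₀) ℂ) *
        (((H⁻¹ : GL (Fin k₀) ℂ) : Matrix (Fin k₀) (Fin k₀) ℂ) * p.1.2 * (H : Matrix (Fin k₀) (Fin k₀) ℂ)) by
          rw [← Matrix.mul_assoc, ← Matrix.mul_assoc, Units.mul_inv, Matrix.one_mul],
      Matrix.toLin'_mul_apply, h0, map_zero]
  · rw [hmemW] at hx ⊢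
    intro p
    obtain ⟨hc, hcn⟩ := radical_conj N γ G H hlift (hJ1 p) (hJ2 p)
    have hmem' : ((((G⁻¹ : GL (Fin k₀) ℂ) : Matrix (Fin k₀) (Fin k₀) ℂ) * p.1.1 * (G : Matrix (Fin k₀) (Fin k₀) ℂ),
        ((H⁻¹ : GL (Fin k₀) ℂ) : Matrix (Fin k₀) (Fin k₀) ℂ) * p.1.2 * (H : Matrix (Fin k₀) (Fin k₀) ℂ)) :
        Matrix (Fin k₀) (Fin k₀) ℂ × Matrix (Fin k₀) (Fin k₀) ℂ) ∈ Jsub := (hmemJ _).2 ⟨hc, hcn⟩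
    have h0 := hx ⟨_, hmem'⟩
    simp only at h0
    rw [← Matrix.toLin'_mul_apply,
      show p.1.1 * (G : Matrix (Fin k₀) (Fin k₀) ℂ) = (G : Matrix (Fin k₀) (Fin k₀) ℂ) *
        (((G⁻¹ : GL (Fin k₀) ℂ) : Matrix (Fin k₀) (Fin k₀) ℂ) * p.1.1 * (G : Matrix (Fin k₀) (Fin k₀) ℂ)) by
          rw [← Matrix.mul_assoc, ← Matrix.mul_assoc, Units.mul_inv, Matrix.one_mul],
      Matrix.toLin'_mul_apply, h0, map_zero]

end Stable

end Summit.ValiantsHypothesis.ValiantsHypothesis.Theorems.FreeSubtorusOrbitDimensionBound.SquareCovering
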